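import Summits.AtomisticToContinuum.Crystallization.Theorems.FrustratedLawDichotomyStrainedPatchSectorTransport
import Summits.AtomisticToContinuum.Crystallization.Theorems.FrustratedLawDichotomyAperiodicGapRecordJunctionHysteresis

/-!
# FrustratedLawDichotomy · crux `AperiodicFrustratedLawGap` (stmt-AtomisticToContinuum-27623) — THE HYSTERESIS N-CELLS ON THE TRANSPORTED DOOR `𝓡⁺`,
# INSTANTIATED BY NAME (decomp-a2c lens 5, generation 105; structural #42 = #41 `…AperiodicGapRecordJunctionHysteresis` × (131)(132)
# `…StrainedPatchSectorTransportA/…SectorTransport`; DEF-FREE)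

Critic rows 1641 (D) «SECTOR-103: hysteresis is the bookkeeping of record», 1645 (R1)–(R3) «N-cell targets of record after (131)(132): door
`famAnd CompFamilyW (ShearDoorGram (489/500) (9/100) bends1 ν μ δ⁺ νh μh δh⁺)`, band `famAnd CompFamilyW (Dense (257/250))`; instruments unchanged
(`MomentRoom (24/5) κ ≤ 15/32 (1/25) constTol (1/25)` + `RecutGoodA eta30`)», hand-2 g43 note (02:04:25Z) «instantiate #41 §2 `coreOff_26_5_of_fourSector_split` with
`𝓡′ := 𝓡⁺` and #41 §1 (un-sectored target + glued certificates) by name».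

SOURCE door of the cell (SOURCE-COARSEN-104): `𝓡ᵁ := famAnd (Door (24/25) (9/100)) (WinRW (GramWindow (24/25) ν μ δ) (GramWindow (24/25) νh μh δh))`, the universal-window
door `⊆ ShearDoorGram (24/25) (9/100) bends0 …` (`famAnd_door_winRW_le_shearDoor`); door N-family `𝓝D := famAnd (famAnd 𝓘₀ (Dense dA)) 𝓡ᵁ`, band N-family
`𝓝B := famAnd (famAndNot (famAnd 𝓘₀ (Dense dA)) 𝓡ᵁ) (Dense dB)`.  TRANSPORTED TARGET door `𝓡⁺ := ShearDoorGram (489/500) (9/100) bends1 ν μ δ⁺ νh μh δh⁺` with the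
SHEAR-COLLAR-104 literals `26569·δ⁺ ≥ 25600·δ + 969·(1+μ)²` (both presentations), target band `Dense dB⁺` with `(163/160)·dB ≤ dB⁺` (record `1009/1000 ↦ 257/250`).

* §1 ★★ the three N-CELLS (the g104 scratch cells `check_refineGB_*` of critic row 1645 (A), renamed, VERBATIM proofs):
  `refineGB_door_transport_record` — `RefineGB 𝓝D 𝓗 … (stepPair 𝓡⁺ B₁ (stepPair 𝓟′ B₂ B₃))` from `MomentRoom 𝓝D` + `RecutGoodA 𝓝D eta30` + enclosure on
  `𝓣D := famAnd CompFamilyW 𝓡⁺` + ONE door-table certificate `hP₁` at `B₁` on `famAnd 𝓣D 𝓡⁺` (classes 2, 3 of the target table VACUOUS, #41 §1 glue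
  `refineGB_stepPair3_of_kernelCut_glued` at (132) `balancedRefit_affBal_shearDoorGram_record`);
  `refineGB_band_transport_record` — `RefineGB 𝓝B 𝓗 … (stepPair 𝓡′ B₁ (stepPair (Dense dB⁺) B₂ B₃))` from `MomentRoom 𝓝B` + `RecutGoodA 𝓝B eta30` + enclosure on
  `𝓣B := famAnd CompFamilyW (Dense dB⁺)` + collar certificate at `B₁` on `famAnd 𝓣B 𝓡′` + main certificate at `B₂` on `famAnd (famAndNot 𝓣B 𝓡′) (Dense dB⁺)` (class 3 VACUOUS);
  `refineGB_door_transport_collarB2` — the «collar read at `B₂`» instantiation (critic row 1645 (R1) decision rule, second branch): classes keyed by ANY record door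
  `𝓡rec`, `𝓟′ := Dense dB⁺` with `489/500 < dB⁺`, certificates at `B₁` on `famAnd 𝓣D 𝓡rec` and at `B₂` on the collar `famAnd (famAndNot 𝓣D 𝓡rec) (Dense dB⁺)`.
* §2 ★★ the JUNCTION by name: `coreOff_26_5_of_fourSector_transport_record` / `rim_26_5_of_fourSector_transport_record` = #41 §2
  `coreOff_26_5_of_fourSector_split` / `rim_…` at `𝓡 := 𝓡ᵁ`, `𝓡′ := 𝓡⁺`, `𝓟′ := Dense dB⁺` with (N∣𝔇′) := §1 door cell and (N∣𝔅lo) := §1 band cell ((N∣𝔅hi) a binder);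
  `coreOff_26_5_of_fourSector_transport_collarB2` — the same junction on the second branch (`𝓡′ := 𝓡rec`).
* §3 ★★★ the 27623 CONSUMERS with the transported N-cells: `aperiodicFrustratedLawGap_of_semOKF_semOKHQ_fourSector_transport_A35000_T26_record` (H-side in the QUOTIENT
  currency: the two Booleans; #41 §3 bare-floor consumer at `homFloor_of_semOKF_semOKHQ`) and `aperiodicFrustratedLawGap_of_semOKF_windowPieces_fourSector_transport_A35000_T26_record`
  (H-side in the ξ-WINDOW currency of #38: fcc Boolean ∧ `XiTube Zone σ̂ r` ∧ hcp floor on (zone ∧ tube) ∧ hcp floor off the zone, `…XiWindowQuot.homFloor_of_semOKF_windowPieces`)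
  and `aperiodicFrustratedLawGap_of_semOKF_homFloorHcp_fourSector_transport_A35000_T26_record` (H-side = fcc Boolean ∧ the BARE hcp floor `(H∣hcp, ⊤)`, the
  currency every window architecture — global sheet, frame-local sheets (`…StrainedPatchHomShearFrames`), flat window — pays into).

CENSUS READING (the binders that are instruments, unchanged from #41/(132)): E-cells `hED hEBlo hEBhi` on the SOURCE fine family `𝓘` keyed by the TARGET predicates `𝓡⁺` /
`Dense dB⁺` at `B₁/B₂/B₃`, `hEA`; cover `hK`; door N: `hRD` MomentRoom, `hGD` RecutGoodA eta30, `hEncD`, `hPD₁`; band N: `hRB`, `hGB`, `hEncB`, `hPB₁`, `hPB₂`; sparse band `hNBhi`;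
hulls `h𝓗D h𝓗B h𝓗 h𝓘`; cap `hcap`.  One-line compositions of landed theorems; 0 sorry; no definitions; standard axioms.  `--supports stmt-AtomisticToContinuum-27623`.
[folklore instantiation]

SPLIT EDITION (hand-2 g43 landing lane; the node sha16 91070fb7b256c751 is 515 l > the gate's 400-l cap for files with proofs): THIS FILE = part 1/2 = §1–§2 verbatim
(the three hysteresis N-cells on the transported targets; the four-sector junction with the transported N-cells); part 2/2 = `…AperiodicGapRecordJunctionTransport`
(imports this file) = §3 verbatim (the 27623 consumers).  Declarations, statements and proofs byte-identical to the node; only the file boundary, the re-opened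
namespace/opens of part 2 and this note are new.
-/

noncomputable section

open scoped BigOperators Classical RealInnerProductSpace
open Literature.Analysis.ValidatedNumerics.Numerics
open Summit.AtomisticToContinuum.Crystallization.Theorems.ChargedEnergyGapNegative (eStar E3)
open Summit.AtomisticToContinuum.Crystallization.Theorems.FrustratedLawDichotomyRangeCut
open Summit.AtomisticToContinuum.Crystallization.Theorems.FrustratedLawDichotomySchurCut
open Summit.AtomisticToContinuum.Crystallization.Theorems.FrustratedLawDichotomyMotifLemmas (GoodAtScale)
open Summit.AtomisticToContinuum.Crystallization.Theorems.FrustratedLawDichotomyAveragingCut (ballAvg)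
open Summit.AtomisticToContinuum.Crystallization.Theorems.FrustratedLawDichotomyExemptLocOpt (LocOptFails)
open Summit.AtomisticToContinuum.Crystallization.Theorems.FrustratedLawDichotomyExemptSplit (SchurElasticPricingX)
open Summit.AtomisticToContinuum.Crystallization.Theorems.FrustratedLawDichotomyExemptAbsorptionRecord
open Summit.AtomisticToContinuum.Crystallization.Theorems.FrustratedLawDichotomyCollarCensus
open Summit.AtomisticToContinuum.Crystallization.Theorems.FrustratedLawDichotomyCollarCensusKappa
open Summit.AtomisticToContinuum.Crystallization.Theorems.FrustratedLawDichotomyStrainedPatchHomSplit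
open Summit.AtomisticToContinuum.Crystallization.Theorems.FrustratedLawDichotomyStrainedPatchCleanCollar (CleanBall TailPenalty AnnularDefectFloor
  DefectiveCollarFloor tailOut)
open Summit.AtomisticToContinuum.Crystallization.Theorems.FrustratedLawDichotomyStrainedPatchPhaseCut (MonoPhaseBall AnnularPhaseFloor PolyTextureFloor)
open Summit.AtomisticToContinuum.Crystallization.Theorems.FrustratedLawDichotomyStrainedPatchCoreTube (NearHomIsoAt CoreOffTubeFloor RimOffTubeFloor)
open Summit.AtomisticToContinuum.Crystallization.Theorems.FrustratedLawDichotomyStrainedPatchCoreTubeRecord (CoreCoreRelief)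
open Summit.AtomisticToContinuum.Crystallization.Theorems.FrustratedLawDichotomyStrainedPatchChartFamilies (ChartBy FamilyLE familyLE_refl)
open Summit.AtomisticToContinuum.Crystallization.Theorems.FrustratedLawDichotomyStrainedPatchChartFamiliesBent
open Summit.AtomisticToContinuum.Crystallization.Theorems.FrustratedLawDichotomyStrainedPatchChartFamiliesPinned
open Summit.AtomisticToContinuum.Crystallization.Theorems.FrustratedLawDichotomyStrainedPatchEnvelopeLaw (dev bends1)
open Summit.AtomisticToContinuum.Crystallization.Theorems.FrustratedLawDichotomyStrainedPatchQuantSlaving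
open Summit.AtomisticToContinuum.Crystallization.Theorems.FrustratedLawDichotomyStrainedPatchHostCells (TubeFloor)
open Summit.AtomisticToContinuum.Crystallization.Theorems.FrustratedLawDichotomyStrainedPatchGradedTube
open Summit.AtomisticToContinuum.Crystallization.Theorems.FrustratedLawDichotomyStrainedPatchCoverBridge
open Summit.AtomisticToContinuum.Crystallization.Theorems.FrustratedLawDichotomyStrainedPatchPairTube
open Summit.AtomisticToContinuum.Crystallization.Theorems.FrustratedLawDichotomyStrainedPatchKernelCut
open Summit.AtomisticToContinuum.Crystallization.Theorems.FrustratedLawDichotomyStrainedPatchWindowFamilies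
open Summit.AtomisticToContinuum.Crystallization.Theorems.FrustratedLawDichotomyStrainedPatchHomEntryGram (rootC rootW)
open Summit.AtomisticToContinuum.Crystallization.Theorems.FrustratedLawDichotomyStrainedPatchHomEntryLeafHT (semOKF)
open Summit.AtomisticToContinuum.Crystallization.Theorems.FrustratedLawDichotomyStrainedPatchHomEntrySemanticQuot (semOKHQ rootCHQ rootWHQ)
open Summit.AtomisticToContinuum.Crystallization.Theorems.FrustratedLawDichotomyStrainedPatchHomXiWindow (XiTube HomFloorHcp homFloor_iff_fcc_and_hcp)
open Summit.AtomisticToContinuum.Crystallization.Theorems.FrustratedLawDichotomyAperiodicGapRecordJunctionXiWindowQuot (homFloor_of_semOKF_windowPieces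
  homFloorFcc_top_of_semOKF)
open Summit.AtomisticToContinuum.Crystallization.Theorems.FrustratedLawDichotomyAperiodicGapRecordJunctionHomFloorF6pT26
open Summit.AtomisticToContinuum.Crystallization.Theorems.FrustratedLawDichotomyAperiodicGapRecordJunctionHomFloorF6pT26Quot (homFloor_of_semOKF_semOKHQ)
open Summit.AtomisticToContinuum.Crystallization.Theorems.FrustratedLawDichotomyAperiodicGapRecordJunctionFallbackLever (rim_of_coreOffTubeFloor)
open Summit.AtomisticToContinuum.Crystallization.Theorems.FrustratedLawDichotomyStrainedPatchConeAnatomy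
open Summit.AtomisticToContinuum.Crystallization.Theorems.FrustratedLawDichotomyStrainedPatchStiffSector
open Summit.AtomisticToContinuum.Crystallization.Theorems.FrustratedLawDichotomyStrainedPatchStiffDoor
open Summit.AtomisticToContinuum.Crystallization.Theorems.FrustratedLawDichotomyStrainedPatchKernelCutSector
open Summit.AtomisticToContinuum.Crystallization.Theorems.FrustratedLawDichotomyStrainedPatchShearDoor
open Summit.AtomisticToContinuum.Crystallization.Theorems.FrustratedLawDichotomyStrainedPatchPairTubeCollar
open Summit.AtomisticToContinuum.Crystallization.Theorems.FrustratedLawDichotomyStrainedPatchAffineCut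
open Summit.AtomisticToContinuum.Crystallization.Theorems.FrustratedLawDichotomyStrainedPatchRecutRecord (ChartFamilyRW)
open Summit.AtomisticToContinuum.Crystallization.Theorems.FrustratedLawDichotomyStrainedPatchRecutLevel
open Summit.AtomisticToContinuum.Crystallization.Theorems.FrustratedLawDichotomyStrainedPatchSectorTransport
open Summit.AtomisticToContinuum.Crystallization.Theorems.FrustratedLawDichotomyAperiodicGapRecordJunctionFourSectorCollar
open Summit.AtomisticToContinuum.Crystallization.Theorems.FrustratedLawDichotomyAperiodicGapRecordJunctionStepPairKernelCut
open Summit.AtomisticToContinuum.Crystallization.Theorems.FrustratedLawDichotomyAperiodicGapRecordJunctionHysteresis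

namespace Summit.AtomisticToContinuum.Crystallization.Theorems.FrustratedLawDichotomyAperiodicGapRecordJunctionTransport

/-! ## §1. The three hysteresis N-cells on the transported targets -/

section Cells

variable {𝓘₀ 𝓗 𝓡 𝓡' 𝓟' 𝓡rec : ChartFam} {dA dB dB' ν μ δ δ' νh μh δh δh' κ κE σ : ℝ} {H : HessTab} {F : ForceTab} {X : SlackTab} {B₁ B₂ B₃ : PairTab}

/-- ★★ **DOOR N-CELL ON THE TRANSPORTED DOOR** (instantiation 1 of record, critic row 1645 (R1) first branch): source `𝓝D := famAnd (famAnd 𝓘₀ (Dense dA)) 𝓡ᵁ`, target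
`𝓣D := famAnd CompFamilyW 𝓡⁺`; census items: `MomentRoom`, `RecutGoodA eta30`, the enclosure on `𝓣D`, ONE door-table certificate `hP₁` at `B₁` on `famAnd 𝓣D 𝓡⁺`; classes 2 and 3 of
the target table `stepPair 𝓡⁺ B₁ (stepPair 𝓟′ B₂ B₃)` are VACUOUS. [folklore instantiation: #41 `refineGB_stepPair3_of_kernelCut_glued` at (132) `balancedRefit_affBal_shearDoorGram_record`] -/
theorem refineGB_door_transport_record (h𝓘₀ : FamilyLE 𝓘₀ ChartFamilyRW)
    (hν : -1 ≤ ν) (hμ : -1 ≤ μ) (hνh : -1 ≤ νh) (hμh : -1 ≤ μh) (hδ0 : 0 ≤ δ) (hδh0 : 0 ≤ δh)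
    (hδ' : 25600 * δ + 969 * (1 + μ) ^ 2 ≤ 26569 * δ') (hδh' : 25600 * δh + 969 * (1 + μh) ^ 2 ≤ 26569 * δh') (hκ0 : 0 ≤ κ) (hκ : κ ≤ 15 / 32)
    (hR : MomentRoom (famAnd (famAnd 𝓘₀ (Dense dA)) (famAnd (Door (24 / 25) (9 / 100)) (WinRW (GramWindow (24 / 25) ν μ δ) (GramWindow (24 / 25) νh μh δh))))
      (24 / 5) κ (1 / 25) (constTol (1 / 25)))
    (hG : RecutGoodA (famAnd (famAnd 𝓘₀ (Dense dA)) (famAnd (Door (24 / 25) (9 / 100)) (WinRW (GramWindow (24 / 25) ν μ δ) (GramWindow (24 / 25) νh μh δh))))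
      eta30)
    (h𝓗 : FamilyLE (famAnd CompFamilyW (ShearDoorGram (489 / 500) (9 / 100) bends1 ν μ δ' νh μh δh')) 𝓗)
    (hEnc : SlavingEnclosureG (famAnd CompFamilyW (ShearDoorGram (489 / 500) (9 / 100) bends1 ν μ δ' νh μh δh')) (affBal (24 / 5)) (26 / 5) (1 / 100) (1 / 8)
      tauA (affTol (1 / 25) (1 / 52)) κE σ H F X)
    (hP₁ : PairKernelCert (famAnd (famAnd CompFamilyW (ShearDoorGram (489 / 500) (9 / 100) bends1 ν μ δ' νh μh δh'))
      (ShearDoorGram (489 / 500) (9 / 100) bends1 ν μ δ' νh μh δh')) (affBal (24 / 5)) tauA (affTol (1 / 25) (1 / 52)) κE σ H F X (1 / 25)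
      (constTol (1 / 25)) B₁) :
    RefineGB (famAnd (famAnd 𝓘₀ (Dense dA)) (famAnd (Door (24 / 25) (9 / 100)) (WinRW (GramWindow (24 / 25) ν μ δ) (GramWindow (24 / 25) νh μh δh)))) 𝓗
      (26 / 5) (1 / 100) (1 / 8) (1 / 25) (constTol (1 / 25)) (1 / 25) (constTol (1 / 25))
      (stepPair (ShearDoorGram (489 / 500) (9 / 100) bends1 ν μ δ' νh μh δh') B₁ (stepPair 𝓟' B₂ B₃)) :=
  refineGB_stepPair3_of_kernelCut_glued h𝓗 (balancedRefit_affBal_shearDoorGram_record h𝓘₀ hν hμ hνh hμh hδ0 hδh0 hδ' hδh' hκ0 hκ hR hG) hEnc hP₁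
    (pairKernelCert_of_forall_not fun M₀ z₀ c₀ => not_famAnd_famAndNot_famAnd M₀ z₀ c₀)
    (pairKernelCert_of_forall_not fun M₀ z₀ c₀ => not_famAndNot_famAndNot_famAnd M₀ z₀ c₀)

/-- ★★ **BAND N-CELL ON THE TRANSPORTED BAND**: source `𝓝B := famAnd (famAndNot (famAnd 𝓘₀ (Dense dA)) 𝓡) (Dense dB)` (`dB ≤ 3`), target `𝓣B := famAnd CompFamilyW (Dense dB⁺)`,
`(163/160)·dB ≤ dB⁺`; census items: `MomentRoom`, `RecutGoodA eta30`, the enclosure on `𝓣B`, the collar certificate at `B₁` on `famAnd 𝓣B 𝓡′`, the main certificate at `B₂` on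
`famAnd (famAndNot 𝓣B 𝓡′) (Dense dB⁺)`; class 3 of `stepPair 𝓡′ B₁ (stepPair (Dense dB⁺) B₂ B₃)` is VACUOUS. [folklore instantiation: #41 glue at (132) `balancedRefit_affBal_dense_record`] -/
theorem refineGB_band_transport_record (h𝓘₀ : FamilyLE 𝓘₀ ChartFamilyRW) (hdB : dB ≤ 3) (hdB' : (163 / 160) * dB ≤ dB') (hκ0 : 0 ≤ κ) (hκ : κ ≤ 15 / 32)
    (hR : MomentRoom (famAnd (famAndNot (famAnd 𝓘₀ (Dense dA)) 𝓡) (Dense dB)) (24 / 5) κ (1 / 25) (constTol (1 / 25)))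
    (hG : RecutGoodA (famAnd (famAndNot (famAnd 𝓘₀ (Dense dA)) 𝓡) (Dense dB)) eta30)
    (h𝓗 : FamilyLE (famAnd CompFamilyW (Dense dB')) 𝓗)
    (hEnc : SlavingEnclosureG (famAnd CompFamilyW (Dense dB')) (affBal (24 / 5)) (26 / 5) (1 / 100) (1 / 8) tauA (affTol (1 / 25) (1 / 52)) κE σ H F X)
    (hP₁ : PairKernelCert (famAnd (famAnd CompFamilyW (Dense dB')) 𝓡') (affBal (24 / 5)) tauA (affTol (1 / 25) (1 / 52)) κE σ H F X (1 / 25)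
      (constTol (1 / 25)) B₁)
    (hP₂ : PairKernelCert (famAnd (famAndNot (famAnd CompFamilyW (Dense dB')) 𝓡') (Dense dB')) (affBal (24 / 5)) tauA (affTol (1 / 25) (1 / 52)) κE σ H F X
      (1 / 25) (constTol (1 / 25)) B₂) :
    RefineGB (famAnd (famAndNot (famAnd 𝓘₀ (Dense dA)) 𝓡) (Dense dB)) 𝓗 (26 / 5) (1 / 100) (1 / 8) (1 / 25) (constTol (1 / 25)) (1 / 25) (constTol (1 / 25))
      (stepPair 𝓡' B₁ (stepPair (Dense dB') B₂ B₃)) :=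
  refineGB_stepPair3_of_kernelCut_glued h𝓗 (balancedRefit_affBal_dense_record h𝓘₀ hdB hdB' hκ0 hκ hR hG) hEnc hP₁ hP₂
    (pairKernelCert_of_forall_not fun M₀ z₀ c₀ => not_famAndNot_famAndNot_famAnd' M₀ z₀ c₀)

/-- ★★ **DOOR N-CELL, «COLLAR READ AT `B₂`»** (instantiation 2, critic row 1645 (R1) second branch): table classes keyed by the RECORD door `𝓡rec` (any class) and
`𝓟′ := Dense dB⁺` with `489/500 < dB⁺`; class 2 = the transported collar `𝓣D ∧ ¬𝓡rec ∧ Dense dB⁺` certified at `B₂` (census item), class 3 VACUOUS by confinement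
(`famAnd_shearDoorGram_le_dense`). [folklore instantiation] -/
theorem refineGB_door_transport_collarB2 (h𝓘₀ : FamilyLE 𝓘₀ ChartFamilyRW) (hdB' : (489 / 500 : ℝ) < dB')
    (hν : -1 ≤ ν) (hμ : -1 ≤ μ) (hνh : -1 ≤ νh) (hμh : -1 ≤ μh) (hδ0 : 0 ≤ δ) (hδh0 : 0 ≤ δh)
    (hδ' : 25600 * δ + 969 * (1 + μ) ^ 2 ≤ 26569 * δ') (hδh' : 25600 * δh + 969 * (1 + μh) ^ 2 ≤ 26569 * δh') (hκ0 : 0 ≤ κ) (hκ : κ ≤ 15 / 32)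
    (hR : MomentRoom (famAnd (famAnd 𝓘₀ (Dense dA)) (famAnd (Door (24 / 25) (9 / 100)) (WinRW (GramWindow (24 / 25) ν μ δ) (GramWindow (24 / 25) νh μh δh))))
      (24 / 5) κ (1 / 25) (constTol (1 / 25)))
    (hG : RecutGoodA (famAnd (famAnd 𝓘₀ (Dense dA)) (famAnd (Door (24 / 25) (9 / 100)) (WinRW (GramWindow (24 / 25) ν μ δ) (GramWindow (24 / 25) νh μh δh))))
      eta30)
    (h𝓗 : FamilyLE (famAnd CompFamilyW (ShearDoorGram (489 / 500) (9 / 100) bends1 ν μ δ' νh μh δh')) 𝓗)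
    (hEnc : SlavingEnclosureG (famAnd CompFamilyW (ShearDoorGram (489 / 500) (9 / 100) bends1 ν μ δ' νh μh δh')) (affBal (24 / 5)) (26 / 5) (1 / 100) (1 / 8)
      tauA (affTol (1 / 25) (1 / 52)) κE σ H F X)
    (hP₁ : PairKernelCert (famAnd (famAnd CompFamilyW (ShearDoorGram (489 / 500) (9 / 100) bends1 ν μ δ' νh μh δh')) 𝓡rec) (affBal (24 / 5)) tauA
      (affTol (1 / 25) (1 / 52)) κE σ H F X (1 / 25) (constTol (1 / 25)) B₁)
    (hP₂ : PairKernelCert (famAnd (famAndNot (famAnd CompFamilyW (ShearDoorGram (489 / 500) (9 / 100) bends1 ν μ δ' νh μh δh')) 𝓡rec) (Dense dB'))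
      (affBal (24 / 5)) tauA (affTol (1 / 25) (1 / 52)) κE σ H F X (1 / 25) (constTol (1 / 25)) B₂) :
    RefineGB (famAnd (famAnd 𝓘₀ (Dense dA)) (famAnd (Door (24 / 25) (9 / 100)) (WinRW (GramWindow (24 / 25) ν μ δ) (GramWindow (24 / 25) νh μh δh)))) 𝓗
      (26 / 5) (1 / 100) (1 / 8) (1 / 25) (constTol (1 / 25)) (1 / 25) (constTol (1 / 25)) (stepPair 𝓡rec B₁ (stepPair (Dense dB') B₂ B₃)) :=
  refineGB_stepPair3_of_kernelCut_glued h𝓗 (balancedRefit_affBal_shearDoorGram_record h𝓘₀ hν hμ hνh hμh hδ0 hδh0 hδ' hδh' hκ0 hκ hR hG) hEnc hP₁ hP₂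
    (pairKernelCert_of_forall_not fun M₀ z₀ c₀ => not_famAndNot_famAndNot_of_le (famAnd_shearDoorGram_le_dense hdB') M₀ z₀ c₀)

/-- The universal-window SOURCE door `𝓡ᵁ` of the cell sits inside #41's record source door `ShearDoorGram (24/25) (9/100) bends0 …` (so every SOURCE-side census table certified
on the record door restricts to it). [formal bookkeeping: (132) `famAnd_door_winRW_le_shearDoor`] -/
theorem famAnd_doorU_le_record (h𝓘₀ : FamilyLE 𝓘₀ ChartFamilyRW) :
    FamilyLE (famAnd (famAnd 𝓘₀ (Dense dA)) (famAnd (Door (24 / 25) (9 / 100)) (WinRW (GramWindow (24 / 25) ν μ δ) (GramWindow (24 / 25) νh μh δh))))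
      (famAnd (famAnd 𝓘₀ (Dense dA)) (ShearDoorGram (24 / 25) (9 / 100) bends0 ν μ δ νh μh δh)) :=
  famAnd_door_winRW_le_shearDoor fun M₀ z₀ c₀ h => h𝓘₀ M₀ z₀ c₀ h.1

/-- Record collar arithmetic (SHEAR-COLLAR-104): a door shear literal `δ = 23/1000` at `μ = 1/20` transports to any `δ⁺ ≥ 624/10000`
(`25600·0.023 + 969·1.1025 = 1657.12 ≤ 26569·0.0624 = 1657.9`). [arithmetic] -/
example : (25600 : ℝ) * (23 / 1000) + 969 * (1 + 1 / 20) ^ 2 ≤ 26569 * (624 / 10000) := by norm_num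

end Cells

/-! ## §2. The four-sector junction with the transported N-cells, by name (#41 §2 at `𝓡 := 𝓡ᵁ`, `𝓡′ := 𝓡⁺`, `𝓟′ := Dense dB⁺`) -/

section Junction

variable {𝓘₀ 𝓗 𝓘 𝓡rec : ChartFam} {dA dB dB' ν μ δ δ' νh μh δh δh' κ κ' κE κE' σ σ' : ℝ} {H H' : HessTab} {F F' : ForceTab} {X X' : SlackTab}
  {B₁ B₂ B₃ : PairTab}

/-- ★★ **[CORE-FAR] AT `26/5` WITH THE TRANSPORTED N-CELLS** (instantiation 1): E-cells on the source fine family `𝓘` keyed by the TARGET classes `𝓡⁺` / `¬𝓡⁺ ∧ Dense dB⁺` /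
`¬𝓡⁺ ∧ ¬Dense dB⁺` at `B₁/B₂/B₃`; door N-cell (§1) from `MomentRoom 𝓝D` + `RecutGoodA 𝓝D eta30` + enclosure + door-table certificate on `𝓣D`; band N-cell (§1) from
`MomentRoom 𝓝B` + `RecutGoodA 𝓝B eta30` + enclosure + collar/main certificates on `𝓣B`; sparse band (N∣𝔅hi) a binder; cover, hulls, cap ⟹ `CoreOffTubeFloor (63/10) (63/10) (26/5) (1/100) 0`.
[folklore instantiation: #41 `coreOff_26_5_of_fourSector_split`] -/
theorem coreOff_26_5_of_fourSector_transport_record (h𝓘₀ : FamilyLE 𝓘₀ ChartFamilyRW)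
    (hν : -1 ≤ ν) (hμ : -1 ≤ μ) (hνh : -1 ≤ νh) (hμh : -1 ≤ μh) (hδ0 : 0 ≤ δ) (hδh0 : 0 ≤ δh)
    (hδ' : 25600 * δ + 969 * (1 + μ) ^ 2 ≤ 26569 * δ') (hδh' : 25600 * δh + 969 * (1 + μh) ^ 2 ≤ 26569 * δh') (hdB : dB ≤ 3) (hdB' : (163 / 160) * dB ≤ dB')
    (hED : TubeFloorGB (famAnd (famAnd 𝓘 (Dense dA)) (ShearDoorGram (489 / 500) (9 / 100) bends1 ν μ δ' νh μh δh')) (1 / 25) (constTol (1 / 25)) B₁)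
    (hEBlo : TubeFloorGB (famAnd (famAndNot (famAnd 𝓘 (Dense dA)) (ShearDoorGram (489 / 500) (9 / 100) bends1 ν μ δ' νh μh δh')) (Dense dB')) (1 / 25)
      (constTol (1 / 25)) B₂)
    (hEBhi : TubeFloorGB (famAndNot (famAndNot (famAnd 𝓘 (Dense dA)) (ShearDoorGram (489 / 500) (9 / 100) bends1 ν μ δ' νh μh δh')) (Dense dB')) (1 / 25)
      (constTol (1 / 25)) B₃)
    (hEA : TubeFloor (famAndNot 𝓘 (Dense dA)) (1 / 25)) (hK : FamilyCoverGRecAt 𝓘₀ (26 / 5) (1 / 100))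
    (hκ0 : 0 ≤ κ) (hκ : κ ≤ 15 / 32)
    (hRD : MomentRoom (famAnd (famAnd 𝓘₀ (Dense dA)) (famAnd (Door (24 / 25) (9 / 100)) (WinRW (GramWindow (24 / 25) ν μ δ) (GramWindow (24 / 25) νh μh δh))))
      (24 / 5) κ (1 / 25) (constTol (1 / 25)))
    (hGD : RecutGoodA (famAnd (famAnd 𝓘₀ (Dense dA)) (famAnd (Door (24 / 25) (9 / 100)) (WinRW (GramWindow (24 / 25) ν μ δ) (GramWindow (24 / 25) νh μh δh))))
      eta30)
    (h𝓗D : FamilyLE (famAnd CompFamilyW (ShearDoorGram (489 / 500) (9 / 100) bends1 ν μ δ' νh μh δh')) 𝓗)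
    (hEncD : SlavingEnclosureG (famAnd CompFamilyW (ShearDoorGram (489 / 500) (9 / 100) bends1 ν μ δ' νh μh δh')) (affBal (24 / 5)) (26 / 5) (1 / 100) (1 / 8)
      tauA (affTol (1 / 25) (1 / 52)) κE σ H F X)
    (hPD₁ : PairKernelCert (famAnd (famAnd CompFamilyW (ShearDoorGram (489 / 500) (9 / 100) bends1 ν μ δ' νh μh δh'))
      (ShearDoorGram (489 / 500) (9 / 100) bends1 ν μ δ' νh μh δh')) (affBal (24 / 5)) tauA (affTol (1 / 25) (1 / 52)) κE σ H F X (1 / 25)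
      (constTol (1 / 25)) B₁)
    (hκ0' : 0 ≤ κ') (hκ' : κ' ≤ 15 / 32)
    (hRB : MomentRoom (famAnd (famAndNot (famAnd 𝓘₀ (Dense dA)) (famAnd (Door (24 / 25) (9 / 100)) (WinRW (GramWindow (24 / 25) ν μ δ) (GramWindow (24 / 25) νh μh δh))))
      (Dense dB)) (24 / 5) κ' (1 / 25) (constTol (1 / 25)))
    (hGB : RecutGoodA (famAnd (famAndNot (famAnd 𝓘₀ (Dense dA)) (famAnd (Door (24 / 25) (9 / 100)) (WinRW (GramWindow (24 / 25) ν μ δ) (GramWindow (24 / 25) νh μh δh))))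
      (Dense dB)) eta30)
    (h𝓗B : FamilyLE (famAnd CompFamilyW (Dense dB')) 𝓗)
    (hEncB : SlavingEnclosureG (famAnd CompFamilyW (Dense dB')) (affBal (24 / 5)) (26 / 5) (1 / 100) (1 / 8) tauA (affTol (1 / 25) (1 / 52)) κE' σ' H' F' X')
    (hPB₁ : PairKernelCert (famAnd (famAnd CompFamilyW (Dense dB')) (ShearDoorGram (489 / 500) (9 / 100) bends1 ν μ δ' νh μh δh')) (affBal (24 / 5)) tauA
      (affTol (1 / 25) (1 / 52)) κE' σ' H' F' X' (1 / 25) (constTol (1 / 25)) B₁)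
    (hPB₂ : PairKernelCert (famAnd (famAndNot (famAnd CompFamilyW (Dense dB')) (ShearDoorGram (489 / 500) (9 / 100) bends1 ν μ δ' νh μh δh')) (Dense dB'))
      (affBal (24 / 5)) tauA (affTol (1 / 25) (1 / 52)) κE' σ' H' F' X' (1 / 25) (constTol (1 / 25)) B₂)
    (hNBhi : RefineGB (famAndNot (famAndNot (famAnd 𝓘₀ (Dense dA)) (famAnd (Door (24 / 25) (9 / 100)) (WinRW (GramWindow (24 / 25) ν μ δ) (GramWindow (24 / 25) νh μh δh))))
      (Dense dB)) 𝓗 (26 / 5) (1 / 100) (1 / 8) (1 / 25) (constTol (1 / 25)) (1 / 25) (constTol (1 / 25))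
      (stepPair (ShearDoorGram (489 / 500) (9 / 100) bends1 ν μ δ' νh μh δh') B₁ (stepPair (Dense dB') B₂ B₃)))
    (h𝓗 : FamilyLE (famAndNot 𝓘₀ (Dense dA)) 𝓗)
    (hcap : PairLE (stepPair (ShearDoorGram (489 / 500) (9 / 100) bends1 ν μ δ' νh μh δh') B₁ (stepPair (Dense dB') B₂ B₃)) (pairSum (constTol (1 / 25))))
    (h𝓘 : FamilyLE 𝓗 𝓘) : CoreOffTubeFloor (63 / 10) (63 / 10) (26 / 5) (1 / 100) 0 :=
  coreOff_26_5_of_fourSector_split hED hEBlo hEBhi hEA hK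
    (refineGB_door_transport_record h𝓘₀ hν hμ hνh hμh hδ0 hδh0 hδ' hδh' hκ0 hκ hRD hGD h𝓗D hEncD hPD₁)
    (refineGB_band_transport_record h𝓘₀ hdB hdB' hκ0' hκ' hRB hGB h𝓗B hEncB hPB₁ hPB₂) hNBhi h𝓗 hcap h𝓘

/-- ★★ **RIM `(24/5, 1/100) → (26/5, 1/100)` with the transported N-cells.** [formal bookkeeping: `rim_of_coreOffTubeFloor`] -/
theorem rim_26_5_of_fourSector_transport_record (h𝓘₀ : FamilyLE 𝓘₀ ChartFamilyRW)
    (hν : -1 ≤ ν) (hμ : -1 ≤ μ) (hνh : -1 ≤ νh) (hμh : -1 ≤ μh) (hδ0 : 0 ≤ δ) (hδh0 : 0 ≤ δh)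
    (hδ' : 25600 * δ + 969 * (1 + μ) ^ 2 ≤ 26569 * δ') (hδh' : 25600 * δh + 969 * (1 + μh) ^ 2 ≤ 26569 * δh') (hdB : dB ≤ 3) (hdB' : (163 / 160) * dB ≤ dB')
    (hED : TubeFloorGB (famAnd (famAnd 𝓘 (Dense dA)) (ShearDoorGram (489 / 500) (9 / 100) bends1 ν μ δ' νh μh δh')) (1 / 25) (constTol (1 / 25)) B₁)
    (hEBlo : TubeFloorGB (famAnd (famAndNot (famAnd 𝓘 (Dense dA)) (ShearDoorGram (489 / 500) (9 / 100) bends1 ν μ δ' νh μh δh')) (Dense dB')) (1 / 25)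
      (constTol (1 / 25)) B₂)
    (hEBhi : TubeFloorGB (famAndNot (famAndNot (famAnd 𝓘 (Dense dA)) (ShearDoorGram (489 / 500) (9 / 100) bends1 ν μ δ' νh μh δh')) (Dense dB')) (1 / 25)
      (constTol (1 / 25)) B₃)
    (hEA : TubeFloor (famAndNot 𝓘 (Dense dA)) (1 / 25)) (hK : FamilyCoverGRecAt 𝓘₀ (26 / 5) (1 / 100))
    (hκ0 : 0 ≤ κ) (hκ : κ ≤ 15 / 32)
    (hRD : MomentRoom (famAnd (famAnd 𝓘₀ (Dense dA)) (famAnd (Door (24 / 25) (9 / 100)) (WinRW (GramWindow (24 / 25) ν μ δ) (GramWindow (24 / 25) νh μh δh))))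
      (24 / 5) κ (1 / 25) (constTol (1 / 25)))
    (hGD : RecutGoodA (famAnd (famAnd 𝓘₀ (Dense dA)) (famAnd (Door (24 / 25) (9 / 100)) (WinRW (GramWindow (24 / 25) ν μ δ) (GramWindow (24 / 25) νh μh δh))))
      eta30)
    (h𝓗D : FamilyLE (famAnd CompFamilyW (ShearDoorGram (489 / 500) (9 / 100) bends1 ν μ δ' νh μh δh')) 𝓗)
    (hEncD : SlavingEnclosureG (famAnd CompFamilyW (ShearDoorGram (489 / 500) (9 / 100) bends1 ν μ δ' νh μh δh')) (affBal (24 / 5)) (26 / 5) (1 / 100) (1 / 8)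
      tauA (affTol (1 / 25) (1 / 52)) κE σ H F X)
    (hPD₁ : PairKernelCert (famAnd (famAnd CompFamilyW (ShearDoorGram (489 / 500) (9 / 100) bends1 ν μ δ' νh μh δh'))
      (ShearDoorGram (489 / 500) (9 / 100) bends1 ν μ δ' νh μh δh')) (affBal (24 / 5)) tauA (affTol (1 / 25) (1 / 52)) κE σ H F X (1 / 25)
      (constTol (1 / 25)) B₁)
    (hκ0' : 0 ≤ κ') (hκ' : κ' ≤ 15 / 32)
    (hRB : MomentRoom (famAnd (famAndNot (famAnd 𝓘₀ (Dense dA)) (famAnd (Door (24 / 25) (9 / 100)) (WinRW (GramWindow (24 / 25) ν μ δ) (GramWindow (24 / 25) νh μh δh))))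
      (Dense dB)) (24 / 5) κ' (1 / 25) (constTol (1 / 25)))
    (hGB : RecutGoodA (famAnd (famAndNot (famAnd 𝓘₀ (Dense dA)) (famAnd (Door (24 / 25) (9 / 100)) (WinRW (GramWindow (24 / 25) ν μ δ) (GramWindow (24 / 25) νh μh δh))))
      (Dense dB)) eta30)
    (h𝓗B : FamilyLE (famAnd CompFamilyW (Dense dB')) 𝓗)
    (hEncB : SlavingEnclosureG (famAnd CompFamilyW (Dense dB')) (affBal (24 / 5)) (26 / 5) (1 / 100) (1 / 8) tauA (affTol (1 / 25) (1 / 52)) κE' σ' H' F' X')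
    (hPB₁ : PairKernelCert (famAnd (famAnd CompFamilyW (Dense dB')) (ShearDoorGram (489 / 500) (9 / 100) bends1 ν μ δ' νh μh δh')) (affBal (24 / 5)) tauA
      (affTol (1 / 25) (1 / 52)) κE' σ' H' F' X' (1 / 25) (constTol (1 / 25)) B₁)
    (hPB₂ : PairKernelCert (famAnd (famAndNot (famAnd CompFamilyW (Dense dB')) (ShearDoorGram (489 / 500) (9 / 100) bends1 ν μ δ' νh μh δh')) (Dense dB'))
      (affBal (24 / 5)) tauA (affTol (1 / 25) (1 / 52)) κE' σ' H' F' X' (1 / 25) (constTol (1 / 25)) B₂)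
    (hNBhi : RefineGB (famAndNot (famAndNot (famAnd 𝓘₀ (Dense dA)) (famAnd (Door (24 / 25) (9 / 100)) (WinRW (GramWindow (24 / 25) ν μ δ) (GramWindow (24 / 25) νh μh δh))))
      (Dense dB)) 𝓗 (26 / 5) (1 / 100) (1 / 8) (1 / 25) (constTol (1 / 25)) (1 / 25) (constTol (1 / 25))
      (stepPair (ShearDoorGram (489 / 500) (9 / 100) bends1 ν μ δ' νh μh δh') B₁ (stepPair (Dense dB') B₂ B₃)))
    (h𝓗 : FamilyLE (famAndNot 𝓘₀ (Dense dA)) 𝓗)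
    (hcap : PairLE (stepPair (ShearDoorGram (489 / 500) (9 / 100) bends1 ν μ δ' νh μh δh') B₁ (stepPair (Dense dB') B₂ B₃)) (pairSum (constTol (1 / 25))))
    (h𝓘 : FamilyLE 𝓗 𝓘) : RimOffTubeFloor (63 / 10) (63 / 10) (24 / 5) (1 / 100) (26 / 5) (1 / 100) 0 :=
  rim_of_coreOffTubeFloor (by norm_num)
    (coreOff_26_5_of_fourSector_transport_record h𝓘₀ hν hμ hνh hμh hδ0 hδh0 hδ' hδh' hdB hdB' hED hEBlo hEBhi hEA hK hκ0 hκ hRD hGD h𝓗D hEncD hPD₁ hκ0' hκ' hRB hGB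
      h𝓗B hEncB hPB₁ hPB₂ hNBhi h𝓗 hcap h𝓘)

/-- ★★ **[CORE-FAR] AT `26/5`, «COLLAR READ AT `B₂`»** (instantiation 2): E-cells and both N-cells keyed by the RECORD door `𝓡rec` and `Dense dB⁺` (`489/500 < dB⁺`); door
N-cell = §1 `refineGB_door_transport_collarB2` (certificates on `famAnd 𝓣D 𝓡rec` at `B₁` and on the transported collar at `B₂`), band N-cell = §1 `refineGB_band_transport_record`
at `𝓡′ := 𝓡rec`. [folklore instantiation: #41 `coreOff_26_5_of_fourSector_split`] -/
theorem coreOff_26_5_of_fourSector_transport_collarB2 (h𝓘₀ : FamilyLE 𝓘₀ ChartFamilyRW) (hrec : (489 / 500 : ℝ) < dB')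
    (hν : -1 ≤ ν) (hμ : -1 ≤ μ) (hνh : -1 ≤ νh) (hμh : -1 ≤ μh) (hδ0 : 0 ≤ δ) (hδh0 : 0 ≤ δh)
    (hδ' : 25600 * δ + 969 * (1 + μ) ^ 2 ≤ 26569 * δ') (hδh' : 25600 * δh + 969 * (1 + μh) ^ 2 ≤ 26569 * δh') (hdB : dB ≤ 3) (hdB' : (163 / 160) * dB ≤ dB')
    (hED : TubeFloorGB (famAnd (famAnd 𝓘 (Dense dA)) 𝓡rec) (1 / 25) (constTol (1 / 25)) B₁)
    (hEBlo : TubeFloorGB (famAnd (famAndNot (famAnd 𝓘 (Dense dA)) 𝓡rec) (Dense dB')) (1 / 25) (constTol (1 / 25)) B₂)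
    (hEBhi : TubeFloorGB (famAndNot (famAndNot (famAnd 𝓘 (Dense dA)) 𝓡rec) (Dense dB')) (1 / 25) (constTol (1 / 25)) B₃)
    (hEA : TubeFloor (famAndNot 𝓘 (Dense dA)) (1 / 25)) (hK : FamilyCoverGRecAt 𝓘₀ (26 / 5) (1 / 100))
    (hκ0 : 0 ≤ κ) (hκ : κ ≤ 15 / 32)
    (hRD : MomentRoom (famAnd (famAnd 𝓘₀ (Dense dA)) (famAnd (Door (24 / 25) (9 / 100)) (WinRW (GramWindow (24 / 25) ν μ δ) (GramWindow (24 / 25) νh μh δh))))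
      (24 / 5) κ (1 / 25) (constTol (1 / 25)))
    (hGD : RecutGoodA (famAnd (famAnd 𝓘₀ (Dense dA)) (famAnd (Door (24 / 25) (9 / 100)) (WinRW (GramWindow (24 / 25) ν μ δ) (GramWindow (24 / 25) νh μh δh))))
      eta30)
    (h𝓗D : FamilyLE (famAnd CompFamilyW (ShearDoorGram (489 / 500) (9 / 100) bends1 ν μ δ' νh μh δh')) 𝓗)
    (hEncD : SlavingEnclosureG (famAnd CompFamilyW (ShearDoorGram (489 / 500) (9 / 100) bends1 ν μ δ' νh μh δh')) (affBal (24 / 5)) (26 / 5) (1 / 100) (1 / 8)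
      tauA (affTol (1 / 25) (1 / 52)) κE σ H F X)
    (hPD₁ : PairKernelCert (famAnd (famAnd CompFamilyW (ShearDoorGram (489 / 500) (9 / 100) bends1 ν μ δ' νh μh δh')) 𝓡rec) (affBal (24 / 5)) tauA
      (affTol (1 / 25) (1 / 52)) κE σ H F X (1 / 25) (constTol (1 / 25)) B₁)
    (hPD₂ : PairKernelCert (famAnd (famAndNot (famAnd CompFamilyW (ShearDoorGram (489 / 500) (9 / 100) bends1 ν μ δ' νh μh δh')) 𝓡rec) (Dense dB'))
      (affBal (24 / 5)) tauA (affTol (1 / 25) (1 / 52)) κE σ H F X (1 / 25) (constTol (1 / 25)) B₂)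
    (hκ0' : 0 ≤ κ') (hκ' : κ' ≤ 15 / 32)
    (hRB : MomentRoom (famAnd (famAndNot (famAnd 𝓘₀ (Dense dA)) (famAnd (Door (24 / 25) (9 / 100)) (WinRW (GramWindow (24 / 25) ν μ δ) (GramWindow (24 / 25) νh μh δh))))
      (Dense dB)) (24 / 5) κ' (1 / 25) (constTol (1 / 25)))
    (hGB : RecutGoodA (famAnd (famAndNot (famAnd 𝓘₀ (Dense dA)) (famAnd (Door (24 / 25) (9 / 100)) (WinRW (GramWindow (24 / 25) ν μ δ) (GramWindow (24 / 25) νh μh δh))))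
      (Dense dB)) eta30)
    (h𝓗B : FamilyLE (famAnd CompFamilyW (Dense dB')) 𝓗)
    (hEncB : SlavingEnclosureG (famAnd CompFamilyW (Dense dB')) (affBal (24 / 5)) (26 / 5) (1 / 100) (1 / 8) tauA (affTol (1 / 25) (1 / 52)) κE' σ' H' F' X')
    (hPB₁ : PairKernelCert (famAnd (famAnd CompFamilyW (Dense dB')) 𝓡rec) (affBal (24 / 5)) tauA (affTol (1 / 25) (1 / 52)) κE' σ' H' F' X' (1 / 25)
      (constTol (1 / 25)) B₁)
    (hPB₂ : PairKernelCert (famAnd (famAndNot (famAnd CompFamilyW (Dense dB')) 𝓡rec) (Dense dB')) (affBal (24 / 5)) tauA (affTol (1 / 25) (1 / 52)) κE' σ' H' F' X'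
      (1 / 25) (constTol (1 / 25)) B₂)
    (hNBhi : RefineGB (famAndNot (famAndNot (famAnd 𝓘₀ (Dense dA)) (famAnd (Door (24 / 25) (9 / 100)) (WinRW (GramWindow (24 / 25) ν μ δ) (GramWindow (24 / 25) νh μh δh))))
      (Dense dB)) 𝓗 (26 / 5) (1 / 100) (1 / 8) (1 / 25) (constTol (1 / 25)) (1 / 25) (constTol (1 / 25)) (stepPair 𝓡rec B₁ (stepPair (Dense dB') B₂ B₃)))
    (h𝓗 : FamilyLE (famAndNot 𝓘₀ (Dense dA)) 𝓗) (hcap : PairLE (stepPair 𝓡rec B₁ (stepPair (Dense dB') B₂ B₃)) (pairSum (constTol (1 / 25))))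
    (h𝓘 : FamilyLE 𝓗 𝓘) : CoreOffTubeFloor (63 / 10) (63 / 10) (26 / 5) (1 / 100) 0 :=
  coreOff_26_5_of_fourSector_split hED hEBlo hEBhi hEA hK
    (refineGB_door_transport_collarB2 h𝓘₀ hrec hν hμ hνh hμh hδ0 hδh0 hδ' hδh' hκ0 hκ hRD hGD h𝓗D hEncD hPD₁ hPD₂)
    (refineGB_band_transport_record h𝓘₀ hdB hdB' hκ0' hκ' hRB hGB h𝓗B hEncB hPB₁ hPB₂) hNBhi h𝓗 hcap h𝓘

end Junction

end Summit.AtomisticToContinuum.Crystallization.Theorems.FrustratedLawDichotomyAperiodicGapRecordJunctionTransport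

end
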